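import Summits.ResolutionOfSingularities.ResolutionOfSingularities.Theorems.EquisingularLiftEquisingularLiftNatD4GeneralTail
import HarnessLib

/-!
# [OURS] GENERAL-TAIL `D₄` VERTICES ⟹ `IsoHypPoint` (`K = K̄`, every characteristic): the vertex corollary of ✓ `towerLevel_origin_D₄_general`
# (cruxes `Theses.EquisingularLift.EquisingularLiftNat` / `…NatThree` / `EquisingularLift`, stmt-ResolutionOfSingularities-20038 / -20148 / -15660)

[OURS · leafhand-res-equisingularlift-12 g1, 2026-09-01; cell `pub/decomp-res`] AI-produced, weaker than expert review; NOT a statement of any manuscript;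
nothing here proves resolution of singularities in positive characteristic.  DEF-FREE helper; no `sorry`; standard axioms; ZERO named hypotheses.

* ★★ `towerLevel_one_vertex_D₄_general` — a vertex `P_c` of `V₊(F)` whose chart is `y₂² + y₀y₁(y₀+y₁) + y₂Q + B` (`Q ∈ (y)²`, `B ∈ (y)⁴` arbitrary, the
  chart equation radical) has `D`-level `1` in every blow-up tower (✓ `towerLevel_vertex_of_origin` + ✓ `towerLevel_origin_D₄_general`);
* ★★★ `isoHypPoint_of_D₄GeneralVertices` — `F` a PRIME form over `K̄` whose charts at the vertices `c ∈ S` are of that shape (tails `Q_c`, `B_c` per vertex),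
  singular only at the origin, and whose other charts are regular ⟹ `IsoHypPoint` (✓ `isoHypPoint_of_towerVertices`).  With arbitrary tails the class is
  a genuine (non-vacuous, open) family of surfaces with `D₄` points — e.g. cubic surfaces `x₀x₁(x₀+x₁) + x₂²x₃ + x₂·q₂(x₀,x₁,x₂)`.

Honest label: the two chart-global hypotheses (`hsing`, `hoff`) depend on the tails and stay with the user.  Closes no registered stub.

References: [Hartshorne1977, I Thm. 5.1, I Ex. 5.6, II Prop. 5.9]; [StacksProject, Tags 0804, 080E]; through the cited tree files.
-/

set_option linter.dupNamespace false -- mandated namespace `Summit.<Summit>.<Problem>` of this single-conjunct summit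

noncomputable section

open CategoryTheory CategoryTheory.Limits AlgebraicGeometry TopologicalSpace Topology
open MvPolynomial
open Literature.AlgebraicGeometry.Resolution Literature.AlgebraicGeometry.Motives
open AlgebraicGeometry.Scheme.IdealSheafData
open Literature.AlgebraicGeometry.Motives.SmoothHypersurface Literature.AlgebraicGeometry.Motives.ProjectiveSpace
open Summit.ResolutionOfSingularities.ResolutionOfSingularities.Cruxes.EquisingularLift.StrataSplit

namespace Summit.ResolutionOfSingularities.ResolutionOfSingularities.Cruxes.EquisingularLiftNat.Sections

/-- The tail `y₀²y₁ + y₀y₁² + (y₂Q + B)` lies in `(y)³` for `Q ∈ (y)²`, `B ∈ (y)⁴`. [folklore] -/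
theorem SecondOrderPoint.D₄_general_tail_mem_pow (K : Type) [Field K] (Q B : MvPolynomial (Fin 3) K)
    (hQ : Q ∈ Ideal.span (Set.range (X : Fin 3 → MvPolynomial (Fin 3) K)) ^ 2)
    (hB : B ∈ Ideal.span (Set.range (X : Fin 3 → MvPolynomial (Fin 3) K)) ^ 4) :
    (X 0 ^ 2 * X 1 + X 0 * X 1 ^ 2 + (X 2 * Q + B) : MvPolynomial (Fin 3) K) ∈ Ideal.span (Set.range (X : Fin 3 → MvPolynomial (Fin 3) K)) ^ (2 + 1) := by
  refine Ideal.add_mem _ (Ideal.add_mem _ ?_ ?_) (Ideal.add_mem _ ?_ (Ideal.pow_le_pow_right (by norm_num) hB))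
  · simpa using SecondOrderPoint.monomial_mem_pow₃ K 2 1 0 (k := 2 + 1) (by norm_num)
  · simpa using SecondOrderPoint.monomial_mem_pow₃ K 1 2 0 (k := 2 + 1) (by norm_num)
  · rw [pow_succ']
    exact Ideal.mul_mem_mul (Ideal.subset_span (Set.mem_range_self (2 : Fin 3))) hQ

/-- ★★ **A GENERAL-TAIL `D₄` VERTEX HAS LEVEL `1`** in every blow-up tower. [OURS] [cite: Hartshorne1977, II Prop. 5.9] [cite: StacksProject, Tag 0804] -/
theorem towerLevel_one_vertex_D₄_general (K : Type) [Field K] (D : ℕ → ∀ Γ : Scheme.{0}, Γ → Prop)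
    (hD0 : ∀ (Γ : Scheme.{0}) (y : Γ), IsClosed (({y} : Set Γ)) →
      (D 0 Γ y ↔ ∀ (hy : IsClosed (({y} : Set Γ))) (Z : Scheme.{0}) (τ : Z ⟶ Γ), IsBlowup τ (vanishingIdeal ⟨{y}, hy⟩) →
        ∀ z : Z, τ z = y → IsRegularLocalRing (Z.presheaf.stalk z)))
    (hDsucc : ∀ (d : ℕ) (Γ : Scheme.{0}) (y : Γ), IsClosed (({y} : Set Γ)) →
      (D (d + 1) Γ y ↔ ∀ (hy : IsClosed (({y} : Set Γ))) (Z : Scheme.{0}) (τ : Z ⟶ Γ), IsBlowup τ (vanishingIdeal ⟨{y}, hy⟩) →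
        ∃ S' : Finset Z, (∀ z : Z, τ z = y → z ∉ S' → IsRegularLocalRing (Z.presheaf.stalk z)) ∧
          ∀ z ∈ S', τ z = y ∧ IsClosed (({z} : Set Z)) ∧ ∃ d' ≤ d, D d' Z z))
    (F : MvPolynomial (Fin (1 + 2 + 1)) K) {d₀ : ℕ} (hF : F.IsHomogeneous d₀) (hd : 0 < d₀) (c : Fin (1 + 2 + 1))
    (Q B : MvPolynomial (Fin 3) K) (hQ : Q ∈ Ideal.span (Set.range (X : Fin 3 → MvPolynomial (Fin 3) K)) ^ 2)
    (hB : B ∈ Ideal.span (Set.range (X : Fin 3 → MvPolynomial (Fin 3) K)) ^ 4)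
    (hdeh : ProjectiveSpace.dehomogenize K c F = (X 2 ^ 2 : MvPolynomial (Fin 3) K) + (X 0 ^ 2 * X 1 + X 0 * X 1 ^ 2 + (X 2 * Q + B)))
    (hrad : (Ideal.span {(X 2 ^ 2 : MvPolynomial (Fin 3) K) + (X 0 ^ 2 * X 1 + X 0 * X 1 ^ 2 + (X 2 * Q + B))}).radical =
      Ideal.span {(X 2 ^ 2 : MvPolynomial (Fin 3) K) + (X 0 ^ 2 * X 1 + X 0 * X 1 ^ 2 + (X 2 * Q + B))}) :
    letI := MvPolynomial.gradedAlgebra (σ := Fin (1 + 2 + 1)) (R := K)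
    ∃ (x₀ : ↥(hypersurface F).left) (_ : IsClosed ({x₀} : Set ↥(hypersurface F).left)),
      (∀ a : Fin (1 + 2 + 1), a ≠ c → (X a : MvPolynomial (Fin (1 + 2 + 1)) K) ∈ ((hypersurfaceι F).left x₀).asHomogeneousIdeal) ∧
      D 1 (hypersurface F).left x₀ :=
  towerLevel_vertex_of_origin K D hD0 hDsucc 1 F hF hd c (X 2 ^ 2) _ (by norm_num) (isHomogeneous_X_pow (2 : Fin 3) 2)
    (SecondOrderPoint.D₄_general_tail_mem_pow K Q B hQ hB) hdeh hrad
    (fun y hy => OneStep.towerLevel_origin_D₄_general K D hD0 hDsucc Q B hQ hB _ rfl y hy)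

/-- ★★★ **GENERAL-TAIL `D₄` VERTICES OF A PRIME SURFACE OVER `K̄` ⟹ `IsoHypPoint`** (every characteristic): `F ∈ K[x₀,…,x₃]` a prime form; at every vertex
`c ∈ S` the chart is `y₂² + y₀y₁(y₀+y₁) + y₂Q_c + B_c` (`Q_c ∈ (y)²`, `B_c ∈ (y)⁴`) and is singular only at the origin; the other charts are regular.
[OURS] [cite: Hartshorne1977, I Thm. 5.1, I Ex. 5.6] [cite: StacksProject, Tag 080E] -/
theorem isoHypPoint_of_D₄GeneralVertices (K : Type) [Field K] [IsAlgClosed K]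
    (F : MvPolynomial (Fin (1 + 2 + 1)) K) {d : ℕ} (hF : F.IsHomogeneous d) (hFp : Prime F) (S : List (Fin (1 + 2 + 1)))
    (Qc Bc : Fin (1 + 2 + 1) → MvPolynomial (Fin 3) K)
    (hQ : ∀ c ∈ S, Qc c ∈ Ideal.span (Set.range (X : Fin 3 → MvPolynomial (Fin 3) K)) ^ 2)
    (hB : ∀ c ∈ S, Bc c ∈ Ideal.span (Set.range (X : Fin 3 → MvPolynomial (Fin 3) K)) ^ 4)
    (hD₄ : ∀ c ∈ S, ProjectiveSpace.dehomogenize K c F = (X 2 ^ 2 : MvPolynomial (Fin 3) K) + (X 0 ^ 2 * X 1 + X 0 * X 1 ^ 2 + (X 2 * Qc c + Bc c)))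
    (hsing : ∀ c ∈ S, ∀ P : Ideal (MvPolynomial (Fin (1 + 2)) K), P.IsPrime → ProjectiveSpace.dehomogenize K c F ∈ P →
      (∀ j, pderiv j (ProjectiveSpace.dehomogenize K c F) ∈ P) → ∀ j, (X j : MvPolynomial (Fin (1 + 2)) K) ∈ P)
    (hoff : letI := MvPolynomial.gradedAlgebra (σ := Fin (1 + 2 + 1)) (R := K)
      ∀ c, c ∉ S → IsRegularRing (ChartRing F c hF)) :
    letI := MvPolynomial.gradedAlgebra (σ := Fin (1 + 2 + 1)) (R := K)
    IsoHypPoint K (1 + 2) (hypersurface F).left (hypersurfaceι F).left := by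
  obtain ⟨D, hD0, hDsucc⟩ := exists_blowupTower
  have hd : 0 < d := ConeN.pos_of_prime_of_isHomogeneous K F hF hFp
  have hΦ : (X 2 ^ 2 : MvPolynomial (Fin 3) K).IsHomogeneous 2 := isHomogeneous_X_pow (2 : Fin 3) 2
  refine isoHypPoint_of_towerVertices K D hD0 hDsucc F hF hFp S
    (fun c hc => ⟨2, X 2 ^ 2, _, le_rfl, hΦ, SecondOrderPoint.D₄_general_tail_mem_pow K _ _ (hQ c hc) (hB c hc), hD₄ c hc⟩) hsing hoff (fun c hc => ?_)
  have hrad := OrdPointAt.radical_span_dehomogenize_eq K F c hF hFp (X 2 ^ 2) _ hΦ (by norm_num)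
    (SecondOrderPoint.D₄_general_tail_mem_pow K _ _ (hQ c hc) (hB c hc)) (hD₄ c hc)
  obtain ⟨x₀, -, hx₀X, hlev⟩ := towerLevel_one_vertex_D₄_general K D hD0 hDsucc F hF hd c (Qc c) (Bc c) (hQ c hc) (hB c hc) (hD₄ c hc) hrad
  exact ⟨x₀, hx₀X, 1, hlev⟩

end Summit.ResolutionOfSingularities.ResolutionOfSingularities.Cruxes.EquisingularLiftNat.Sections

end
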